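import Literature.NumberTheory.NumberFields.QuadraticCompletionAtNonsplitPlace     -- ★ (QP) `subsingleton_placesOver_of_not_isSquare`, (Q2) `algebraMap_adicCompletion_sq_eq_toPlace` (p846255)
import Literature.NumberTheory.NumberFields.LocalSquareClassGlobalRepresentative   -- ★ (Q3) `exists_isSquare_inv_mul_coe` (p846203)
import Literature.NumberTheory.Automorphic.GaloisActionPlaces                       -- ★ `HeightOneSpectrum.under_algEquiv_smul` (`σ • w` lies over the same `v`)
import Mathlib.NumberTheory.RamificationInertia.Unramified
import HarnessLib

/-!
# A QUADRATIC FIELD `E = F(√m)` IS NON-SPLIT AND RAMIFIED AT A FINITE PLACE `v` WHERE `ord_v m` IS ODD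
# («K₁ AS A COMPLETION», ramified half: the dictionary from `ord_v m` odd to the tree's ramified-place currency `(hc, hw, he)`)

Topic `NumberTheory/NumberFields`; namespace `Literature.NumberTheory.NumberFields`.  THEOREMS ONLY (no definition, no instance, no notation, no named fact,
no `sorry`).  Cell `pub/hodgecm-mathlib` (D-0151), crux H413 = `stmt-HodgeConjecture-24833` (`--supports`), infrastructure organ «LQC — K₁ AS A COMPLETION» (A-80 (2);
W2 census `CENSUS-T3prime-P2.addendum1` §B: the splitting field `K₁ = L_w(√disc χ_g)` of the T3′ P-2 rows has `ord_w disc = 2N+1` ODD, so `K₁` is a RAMIFIED quadratic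
extension of the local field, to be realised as the completion `M_𝔓` of a global quadratic `M = L(√m)`).  HONEST LABEL: HC_CM is proved only modulo the printed citations
(hLiu418, h413) until rung 0 closes; this file is unconditional algebraic number theory.

WHAT THIS FILE DOES.  Let `E ∕ F` be number fields, `δ ∈ E` with `δ² = m ∈ F`, `v` a finite place of `F` and `w ∣ v` a place of `E`.  Write `|·|_v`, `|·|_w` for the
`ℤᵐ⁰`-valued valuations of the completions `F_v`, `E_w` and `e = e(w|v) = v.asIdeal.ramificationIdx' w.asIdeal` (so `|ι_w y|_w = |y|_v ^ e`, ★ `valued_toPlace`).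
* §1 (local parity, any `ℤᵐ⁰`-valued field): an element of ODD valuation `exp (2k+1)` is not a square (`not_isSquare_of_valued_eq_exp_odd`), and odd valuation is a
  square-class invariant (`exists_valued_eq_exp_odd_of_isSquare_inv_mul`).
* §2 (the place dictionary): if `|m|_v = exp (2k+1)` is odd then
  - `e(w|v) ≠ 1` (**`ramificationIdx'_ne_one_of_valued_eq_exp_odd`**; Mathlib forms `ramificationIdx_ne_one_…`, **`not_isUnramifiedIn_of_valued_eq_exp_odd`**):
    `|δ|_w ² = |ι_w m|_w = |m|_v ^ e`, and `e = 1` would make an odd integer even;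
  - `v` is non-split in `E`: `Subsingleton (PlacesOver E v)` (`subsingleton_placesOver_of_valued_eq_exp_odd`, from ★ (QP) and §1), hence every `σ ∈ Aut(E∕F)` fixes
    `w` (`smul_placesOver_eq_of_subsingleton`, **`smul_placesOver_eq_of_valued_eq_exp_odd`**);
  - with the quadratic involution `σ` (`σ δ = −δ`, `δ ≠ 0`): `σ ≠ 1` (`algEquiv_ne_one_of_apply_eq_neg`), and the triple **`(hc : σ ≠ 1, hw : σ • w = w, he : e(w|v) ≠ 1)`**
    (`ramifiedPlace_currency_of_valued_eq_exp_odd`) — EXACTLY the binders of the tree's ramified-place package: ★ `Liu2021.…RamifiedPlace.ramificationIdx'_eq_two_of_ne_one`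
    (`e = 2`, i.e. `𝔪_w ² = (ϖ_v)`), ★ `inertiaDeg_eq_one_of_ne_one` (`f = 1`), ★ `natCard_residueField_eq_of_ramified` (`#𝓀_w = #𝓀_v`), ★
    `residueHom_galAdicCompletionMap_eq_id_of_ramified` (`σ̄_w = id`), ★ `exists_unit_not_isNorm_of_ramified` ∕ `exists_isNorm_valued_eq_exp_neg_one_of_ramified` (norm parity),
    ★ `isSquare_residue_toPlace_iff_of_ramified` (residue squares) — all consumable BY NAME with zero glue.
* §3 (from a LOCAL odd class to the GLOBAL model): for `v ∤ 2` and `d ∈ F_v` of odd valuation there is a global `m ∈ F`, `m ≠ 0`, in the square class of `d` (★ (Q3)) and again of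
  odd valuation (`exists_coe_isSquare_inv_mul_and_valued_eq_exp_odd`); with `E := AdjoinRoot (X² − C m)` (★ `isQuadraticExtension_adjoinRoot`, `exists_algEquiv_root_eq_neg`,
  `root_X_sq_sub_C_sq`) §2 applies, and `E_w = F_v ⊕ F_v·√m = F_v(√d) = K₁` (★ (Q2) `existsUnique_eq_toPlace_add_toPlace_mul`).

## References
* [Neukirch1999] J. Neukirch, *Algebraic Number Theory*, Grundlehren 322, Springer (1999): Ch. II §8 (extensions `w ∣ v`, `e(w|v)`, `f(w|v)`, (8.2), (8.5)), Ch. I §8 Prop. (8.2).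
* [SerreLocalFields1979] J.-P. Serre, *Local Fields*, GTM 67, Springer (1979): Ch. I §4 (ramification index and residue degree), Ch. I §6.
* [CasselsFrohlich1967] J. W. S. Cassels, A. Fröhlich (eds.), *Algebraic Number Theory*, Academic Press (1967): Ch. I §5 (ramification), Ch. II §10 (places in extensions).
-/

set_option autoImplicit false

noncomputable section

open NumberField IsDedekindDomain
open Literature.NumberTheory.Automorphic Literature.NumberTheory.Automorphic.UnitaryGroup

namespace Literature.NumberTheory.NumberFields

/-! ## §1 Local parity: odd valuation ⇒ non-square; odd valuation is a square-class invariant -/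

section Parity

variable {K : Type} [Field K] [Valued K (WithZero (Multiplicative ℤ))]

/-- **An element of odd valuation is not a square**: if `|d| = exp (2k+1)` in a `ℤᵐ⁰`-valued field then `d` is not a square (`|r²| = |r|² = exp (2·log |r|)` is even).
[cite: SerreLocalFields1979, Ch. I §4] [cite: Neukirch1999, Ch. II §8] -/
theorem not_isSquare_of_valued_eq_exp_odd {d : K} (k : ℤ) (hd : Valued.v d = WithZero.exp (2 * k + 1)) : ¬ IsSquare d := by
  rintro ⟨r, rfl⟩
  rw [map_mul, ← pow_two] at hd
  have hr0 : Valued.v r ≠ 0 := by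
    intro h0; rw [h0, zero_pow two_ne_zero] at hd; exact WithZero.coe_ne_zero hd.symm
  rw [← WithZero.exp_log hr0, ← WithZero.exp_nsmul, WithZero.exp_inj, nsmul_eq_mul] at hd
  push_cast at hd
  omega

/-- **Odd valuation is a square-class invariant**: if `|d| = exp (2k+1)` and `d⁻¹·x` is a square with `x ≠ 0`, then `|x| = exp (2k'+1)` for some `k'`.
[cite: SerreLocalFields1979, Ch. I §4] [cite: Neukirch1999, Ch. II §8] -/
theorem exists_valued_eq_exp_odd_of_isSquare_inv_mul {d x : K} (k : ℤ) (hd : Valued.v d = WithZero.exp (2 * k + 1)) (hx : IsSquare (d⁻¹ * x)) (hx0 : x ≠ 0) :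
    ∃ k' : ℤ, Valued.v x = WithZero.exp (2 * k' + 1) := by
  obtain ⟨r, hr⟩ := hx
  have hd0 : d ≠ 0 := by
    intro h0; rw [h0, map_zero] at hd; exact WithZero.coe_ne_zero hd.symm
  have hxr : x = d * (r * r) := by rw [← hr, mul_inv_cancel_left₀ hd0]
  have hr0 : Valued.v r ≠ 0 := by
    intro h0
    apply hx0
    rw [hxr, (Valued.v.zero_iff).1 h0 |> fun h => show r * r = 0 by rw [h, mul_zero], mul_zero]
  have hra : Valued.v r = WithZero.exp (WithZero.log (Valued.v r)) := (WithZero.exp_log hr0).symm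
  refine ⟨k + WithZero.log (Valued.v r), ?_⟩
  rw [hxr, map_mul, map_mul, hd, hra, ← WithZero.exp_add, ← WithZero.exp_add, WithZero.log_exp]
  congr 1
  ring

end Parity

/-! ## §2 The place dictionary: `ord_v m` odd ⇒ `e(w|v) ≠ 1`, one place above `v`, fixed by `Aut(E∕F)` -/

section Place

variable {F : Type} (E : Type) [Field F] [NumberField F] [Field E] [NumberField E] [Algebra F E]

/-- **`ord_v m` ODD ⇒ `e(w|v) ≠ 1`** for `E ∋ δ`, `δ² = m ∈ F`, ANY place `w ∣ v` of `E`: `|δ|_w ² = |ι_w m|_w = |m|_v ^ {e(w|v)}` (★ `valued_toPlace`, ★ `algebraMap_adicCompletion_sq_eq_toPlace`),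
so `e(w|v) = 1` would give `2·log|δ|_w = 2k+1`.  (`ramificationIdx'` is the tree's `e(w|v)` token of ★ `valued_toPlace` and of the ramified-place package.)
[cite: Neukirch1999, Ch. II §8] [cite: SerreLocalFields1979, Ch. I §4] -/
theorem ramificationIdx'_ne_one_of_valued_eq_exp_odd (v : HeightOneSpectrum (𝓞 F)) (w : PlacesOver E v) {δ : E} {m : F}
    (hm : algebraMap F E m = δ ^ 2) (k : ℤ) (hval : Valued.v (m : v.adicCompletion F) = WithZero.exp (2 * k + 1)) :
    v.asIdeal.ramificationIdx' w.1.asIdeal ≠ 1 := by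
  intro he
  have h1 := valued_toPlace v w (m : v.adicCompletion F)
  rw [he, pow_one, ← algebraMap_adicCompletion_sq_eq_toPlace E v w hm, map_pow, hval] at h1
  have hδ0 : Valued.v ((δ : E) : w.1.adicCompletion E) ≠ 0 := by
    intro h0; rw [h0, zero_pow two_ne_zero] at h1; exact WithZero.coe_ne_zero h1.symm
  rw [← WithZero.exp_log hδ0, ← WithZero.exp_nsmul, WithZero.exp_inj, nsmul_eq_mul] at h1
  push_cast at h1
  omega

/-- Mathlib form: **`ord_v m` odd ⇒ `w.asIdeal.ramificationIdx (𝓞 F) ≠ 1`** (★ `Ideal.ramificationIdx'_eq_ramificationIdx`). [cite: Neukirch1999, Ch. II §8] -/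
theorem ramificationIdx_ne_one_of_valued_eq_exp_odd (v : HeightOneSpectrum (𝓞 F)) (w : PlacesOver E v) {δ : E} {m : F}
    (hm : algebraMap F E m = δ ^ 2) (k : ℤ) (hval : Valued.v (m : v.adicCompletion F) = WithZero.exp (2 * k + 1)) :
    w.1.asIdeal.ramificationIdx (𝓞 F) ≠ 1 := by
  haveI := PlacesOver.liesOver w
  rw [← Ideal.ramificationIdx'_eq_ramificationIdx v.asIdeal w.1.asIdeal v.ne_bot]
  exact ramificationIdx'_ne_one_of_valued_eq_exp_odd E v w hm k hval

/-- Mathlib form: **`ord_v m` odd ⇒ `v` is RAMIFIED in `E = F(√m)`**: `¬ Algebra.IsUnramifiedIn (𝓞 E) v.asIdeal` (an unramified `v` has `e(w|v) = 1` at every `w ∣ v`,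
Mathlib `Algebra.IsUnramifiedIn.ramificationIdx_eq_one`). [cite: Neukirch1999, Ch. II §8] [cite: SerreLocalFields1979, Ch. I §4] -/
theorem not_isUnramifiedIn_of_valued_eq_exp_odd (v : HeightOneSpectrum (𝓞 F)) (w : PlacesOver E v) {δ : E} {m : F}
    (hm : algebraMap F E m = δ ^ 2) (k : ℤ) (hval : Valued.v (m : v.adicCompletion F) = WithZero.exp (2 * k + 1)) :
    ¬ Algebra.IsUnramifiedIn (𝓞 E) v.asIdeal := fun hunr =>
  ramificationIdx_ne_one_of_valued_eq_exp_odd E v w hm k hval (hunr.ramificationIdx_eq_one (PlacesOver.liesOver w))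

/-- **At a non-split place every `σ ∈ Aut(E∕F)` fixes the place**: if `PlacesOver E v` is a subsingleton then `σ • w = w` (`σ • w` lies over the same `v`, ★ `under_algEquiv_smul`).
This is the `hw` binder of the tree's `galAdicCompletionMap σ hw : E_w ≃ E_w` and of the ramified∕inert place packages. [cite: CasselsFrohlich1967, Ch. II §10] -/
theorem smul_placesOver_eq_of_subsingleton (v : HeightOneSpectrum (𝓞 F)) [Subsingleton (PlacesOver E v)] (σ : E ≃ₐ[F] E) (w : PlacesOver E v) :
    σ • w.1 = w.1 :=
  congrArg Subtype.val (Subsingleton.elim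
    (⟨σ • w.1, (Literature.NumberTheory.Automorphic.HeightOneSpectrum.under_algEquiv_smul F E σ w.1).trans w.2⟩ : PlacesOver E v) w)

omit [NumberField F] [NumberField E] in
/-- The quadratic involution is non-trivial: `σ δ = −δ` with `δ ≠ 0` forces `σ ≠ 1` (characteristic zero). This is the `hc` binder of the place packages. [cite: Neukirch1999, Ch. II §8] -/
theorem algEquiv_ne_one_of_apply_eq_neg [CharZero E] (σ : E ≃ₐ[F] E) {δ : E} (hσδ : σ δ = -δ) (hδ : δ ≠ 0) : σ ≠ 1 := by
  rintro rfl
  exact hδ (self_eq_neg.1 (by simpa only [AlgEquiv.one_apply] using hσδ))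

variable [Algebra.IsQuadraticExtension F E]

/-- **`ord_v m` ODD ⇒ `v` is NON-SPLIT in `E = F(√m)`**: exactly one place of `E` above `v` (★ (QP) `subsingleton_placesOver_of_not_isSquare` + §1: an element of odd valuation is
not a square in `F_v`). [cite: Neukirch1999, Ch. II (8.2)–(8.3)] [cite: CasselsFrohlich1967, Ch. II §10] -/
theorem subsingleton_placesOver_of_valued_eq_exp_odd (v : HeightOneSpectrum (𝓞 F)) (σ : E ≃ₐ[F] E) {δ : E} (hσδ : σ δ = -δ) (hδ : δ ≠ 0) {m : F}
    (hm : algebraMap F E m = δ ^ 2) (k : ℤ) (hval : Valued.v (m : v.adicCompletion F) = WithZero.exp (2 * k + 1)) :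
    Subsingleton (PlacesOver E v) :=
  subsingleton_placesOver_of_not_isSquare E v σ hσδ hδ hm (not_isSquare_of_valued_eq_exp_odd k hval)

/-- **`ord_v m` ODD ⇒ the involution fixes the place above `v`**: `σ • w = w` for every `w ∣ v` (the `hw` binder). [cite: CasselsFrohlich1967, Ch. II §10] -/
theorem smul_placesOver_eq_of_valued_eq_exp_odd (v : HeightOneSpectrum (𝓞 F)) (σ : E ≃ₐ[F] E) {δ : E} (hσδ : σ δ = -δ) (hδ : δ ≠ 0) {m : F}
    (hm : algebraMap F E m = δ ^ 2) (k : ℤ) (hval : Valued.v (m : v.adicCompletion F) = WithZero.exp (2 * k + 1)) (w : PlacesOver E v) :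
    σ • w.1 = w.1 :=
  haveI := subsingleton_placesOver_of_valued_eq_exp_odd E v σ hσδ hδ hm k hval
  smul_placesOver_eq_of_subsingleton E v σ w

/-- **THE RAMIFIED-PLACE CURRENCY AT AN ODD PLACE.**  For the quadratic field `E ∋ δ`, `δ² = m ∈ F`, involution `σ` (`σ δ = −δ`, `δ ≠ 0`) and a place `v` with `|m|_v = exp (2k+1)`:
every `w ∣ v` satisfies `σ ≠ 1 ∧ σ • w = w ∧ e(w|v) ≠ 1` — literally the binders `(hc, hw, he)` of ★ `ramificationIdx'_eq_two_of_ne_one` (`e = 2`: `𝔪_w² = (ϖ_v)`), ★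
`inertiaDeg_eq_one_of_ne_one` (`f = 1`), ★ `natCard_residueField_eq_of_ramified` (`#𝓀_w = #𝓀_v`), ★ `residueHom_galAdicCompletionMap_eq_id_of_ramified` (`σ̄_w = id`), ★
`exists_unit_not_isNorm_of_ramified` (norm parity) and ★ `isSquare_residue_toPlace_iff_of_ramified`. [cite: Neukirch1999, Ch. II §8] [cite: SerreLocalFields1979, Ch. I §4] -/
theorem ramifiedPlace_currency_of_valued_eq_exp_odd (v : HeightOneSpectrum (𝓞 F)) (σ : E ≃ₐ[F] E) {δ : E} (hσδ : σ δ = -δ) (hδ : δ ≠ 0) {m : F}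
    (hm : algebraMap F E m = δ ^ 2) (k : ℤ) (hval : Valued.v (m : v.adicCompletion F) = WithZero.exp (2 * k + 1)) (w : PlacesOver E v) :
    σ ≠ 1 ∧ σ • w.1 = w.1 ∧ v.asIdeal.ramificationIdx' w.1.asIdeal ≠ 1 :=
  ⟨algEquiv_ne_one_of_apply_eq_neg E σ hσδ hδ, smul_placesOver_eq_of_valued_eq_exp_odd E v σ hσδ hδ hm k hval w,
    ramificationIdx'_ne_one_of_valued_eq_exp_odd E v w hm k hval⟩

/-- … and the place above `v` EXISTS and is UNIQUE: `∃! w : PlacesOver E v, True`-free form — `Nonempty (PlacesOver E v) ∧ Subsingleton (PlacesOver E v)` (some place always lies over `v`,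
★ `PlacesOver` is `Nonempty` in the tree; uniqueness from `ord_v m` odd). [cite: Neukirch1999, Ch. II (8.2)–(8.3)] -/
theorem nonempty_and_subsingleton_placesOver_of_valued_eq_exp_odd (v : HeightOneSpectrum (𝓞 F)) (σ : E ≃ₐ[F] E) {δ : E} (hσδ : σ δ = -δ) (hδ : δ ≠ 0) {m : F}
    (hm : algebraMap F E m = δ ^ 2) (k : ℤ) (hval : Valued.v (m : v.adicCompletion F) = WithZero.exp (2 * k + 1)) :
    Nonempty (PlacesOver E v) ∧ Subsingleton (PlacesOver E v) :=
  ⟨inferInstance, subsingleton_placesOver_of_valued_eq_exp_odd E v σ hσδ hδ hm k hval⟩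

end Place

/-! ## §3 From a LOCAL class of odd valuation to a GLOBAL `m` (★ (Q3)) -/

section Global

variable {F : Type} [Field F] [NumberField F] (v : HeightOneSpectrum (𝓞 F))

/-- **A local class of odd valuation has a global representative of odd valuation**: for `v ∤ 2` (`|2|_v = 1`) and `d ∈ F_v` with `|d|_v = exp (2k+1)` there is `m ∈ F`, `m ≠ 0`,
with `d⁻¹·m ∈ (F_v^×)²` (★ (Q3) `exists_isSquare_inv_mul_coe`) and `|m|_v = exp (2k'+1)` odd (§1) — so `F_v(√d) = F_v(√m)` is the completion of the global `F(√m)` at its unique,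
ramified place above `v` (§2, ★ (Q2)). [cite: Neukirch1999, Ch. II (3.4)] [cite: CasselsFrohlich1967, Ch. II §10] -/
theorem exists_coe_isSquare_inv_mul_and_valued_eq_exp_odd (h2 : Valued.v (2 : v.adicCompletion F) = 1) {d : v.adicCompletion F} (k : ℤ)
    (hd : Valued.v d = WithZero.exp (2 * k + 1)) :
    ∃ m : F, m ≠ 0 ∧ IsSquare (d⁻¹ * algebraMap F (v.adicCompletion F) m) ∧ ∃ k' : ℤ, Valued.v (algebraMap F (v.adicCompletion F) m) = WithZero.exp (2 * k' + 1) := by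
  have hd0 : d ≠ 0 := by
    intro h0; rw [h0, map_zero] at hd; exact WithZero.coe_ne_zero hd.symm
  obtain ⟨m, hm0, hsq⟩ := exists_isSquare_inv_mul_coe v h2 hd0
  refine ⟨m, hm0, hsq, exists_valued_eq_exp_odd_of_isSquare_inv_mul k hd hsq ?_⟩
  exact (map_ne_zero_iff _ (algebraMap F (v.adicCompletion F)).injective).2 hm0

end Global

end Literature.NumberTheory.NumberFields

end
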